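import Literature.LinearAlgebra.Matrix.SimilitudeCharpoly
import Literature.LinearAlgebra.Matrix.PfaffianSimilitude
import HarnessLib

/-!
# Goresky–Tai 2017, App. §17.1 (the symplectic similitude group `GSp_{2n}`: block relations, `qγ⁻¹ = (ᵗD −ᵗB; −ᵗC ᵗA)`,
# «`ᵗγ` is also») and §16.2 Lemma 37 (the characteristic polynomial of `γ ∈ GSp_{2n}` of multiplier `q` is
# `q`-palindromic) — for Mathlib's standard form `Matrix.J`

Goresky–Tai, *Real structures on ordinary abelian varieties*, arXiv:1701.07742, Appendix §17.1 p0039 (verbatim):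

> «Denote by `GSp(T, 𝔅)` the set of `g ∈ GL(T)` such that `𝔅(gx, gy) = λ𝔅(x, y)` for some `λ = λ(g) ∈ R^×`.  Then
> `λ` is a character of `GSp(T, 𝔅)` and we say that `g ∈ GSp(T, 𝔅)` has multiplier `λ(g)`. … If `γ ∈ GSp_{2n}(R)`
> then so is `ᵗγ⁻¹`, hence `ᵗγ` is also.  In this case, expressing `γ` as a block matrix, `γ = (A B; C D)` the
> symplectic condition `ᵗγJγ = qJ` is equivalent to: `ᵗA C`, `ᵗB D` are symmetric, and `ᵗA D − ᵗC B = qI` or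
> equivalently, `qγ⁻¹ = (ᵗD −ᵗB; −ᵗC ᵗA)` or `AᵗB`, `CᵗD` are symmetric, and `AᵗD − BᵗC = qI`.»

§16.2 p0036 and Lemma 37 p0037 (verbatim):

> «Let `q ∈ ℚ`.  Let us say that a monic polynomial `p(x) = x^{2n} + a_{2n−1}x^{2n−1} + ⋯ + a₀ ∈ ℂ[x]` is
> *`q`-palindromic* if it has even degree and if `a_{n−r} = q^r a_{n+r}` for `1 ≤ r ≤ n`, or equivalently if
> `q^{−n} x^{2n} p(q/x) = p(x)`.»
> «**Lemma 37.** Let `γ ∈ GSp_{2n}(ℚ)` with multiplier `q ∈ ℚ`.  Then the characteristic polynomial `p(x)` of `γ`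
> is `q`-palindromic.» (printed proof: diagonalise a semisimple `γ = (D 0; 0 D′)` with `DD′ = qI`, so that
> `p(x) = ∏ (x − dᵢ)(x − q/dᵢ)`; general case by Jordan decomposition.)

## What is formalized (Mathlib conventions: `J = Matrix.J m R = (0 −1; 1 0)` — the negative of the printed `J`,
## which changes none of the displayed relations —, `n = #m`, `γ.charpoly = ∑ a_k x^k`)

«`γ ∈ GSp_{2n}(R)` with multiplier `q`» is the hypothesis `γᵀ * J * γ = q • J`; where the print needs `q ∈ R^×`
the multiplier is a unit `u : Rˣ`.  Everything over an ARBITRARY commutative ring `R`.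

* §1 ★ `fromBlocks_transpose_mul_J_mul_eq_smul_J_iff` — «`ᵗγJγ = qJ` is equivalent to: `ᵗA C`, `ᵗB D` are
  symmetric, and `ᵗA D − ᵗC B = qI`», for every `q ∈ R` (the case `q = 1` is Mathlib's
  `Matrix.SymplecticGroup.fromBlocks_mem_iff`), with the block formula `transpose_mul_J_mul_fromBlocks`.
* §2 «or equivalently, `qγ⁻¹ = (ᵗD −ᵗB; −ᵗC ᵗA)`»: `neg_J_mul_transpose_mul_J_fromBlocks` (that matrix is `−JᵗγJ`,
  the `B = J` case of the adjoint `B⁻¹ᵗgB` of the tree's `SimilitudeCharpoly` §7), ★ `fromBlocks_adjugate_mul`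
  (`(ᵗD −ᵗB; −ᵗC ᵗA)·γ = q·1` for every `q`, from the tree's `SimilitudeCharpoly.inv_mul_transpose_mul_mul_eq`),
  ★ `inv_eq_smul_fromBlocks` (unit multiplier: `γ⁻¹ = q⁻¹·(ᵗD −ᵗB; −ᵗC ᵗA)`, from the tree's
  `SimilitudeCharpoly.inv_eq_smul_inv_mul_transpose_mul`); «hence `ᵗγ` is also»: `mul_neg_J_mul_transpose_mul_J`
  (`γ·(−JᵗγJ) = q·1`), ★ `mul_J_mul_transpose_eq_smul_J` (`γJᵗγ = qJ`: the transpose has the same multiplier),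
  `transpose_mul_J_mul_eq_smul_J_iff_mul_J_mul_transpose`; «or `AᵗB`, `CᵗD` are symmetric, and `AᵗD − BᵗC = qI`»:
  ★ `fromBlocks_transpose_mul_J_mul_eq_smul_J_iff'` (unit multiplier).
* §3 **Lemma 37 for `GSp_{2n}`**, as COROLLARIES of the tree's general similitude theory (Book of Involutions
  (12.2)–(12.3): `Literature.LinearAlgebra.Matrix.SimilitudeCharpoly.C_det_mul_charpoly`,
  `….coeff_charpoly_eq_pow_mul_coeff`, stated there for an arbitrary Gram matrix `B` with `det B` regular and with
  `det g` as a parameter) combined with `det γ = qⁿ` for the standard form (the tree's Pfaffian theorem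
  `Literature.LinearAlgebra.Matrix.det_eq_pow_card_of_transpose_mul_J_mul_eq_smul`): ★★
  `det_scalar_sub_X_smul_map` — the form «`q^{−n} x^{2n} p(q/x) = p(x)`» as the polynomial identity
  `det(q·1 − x·γ) = qⁿ·p(x)` in `R[x]` (every `q ∈ R`); ★★★ **`charpoly_coeff_eq_pow_mul_charpoly_coeff` — Lemma 37
  as printed, `a_{n−r} = q^r a_{n+r}` for `r ≤ n`**, for every regular (non-zero-divisor) multiplier `q`, e.g. any
  `q ≠ 0` in an integral domain (`isRegular_of_ne_zero'`) such as `γ ∈ GSp_{2n}(ℚ)` or an integer similitude of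
  multiplier `pᵃ`.

THEOREMS ONLY; no definition, instance, notation or named fact.  Not restated here (they are in the tree):
`det γ = qⁿ` (`PfaffianSimilitude`), the palindromic case `q = 1` (`SymplecticCharpolyReciprocal.reverse_charpoly_of_mem`),
`p_{γ⁻¹} = p_{q⁻¹γ}` and the root pairing `α ↔ q/α` (`SimilitudeCharpoly` §3–§7).

## References

* [GoreskyTai2017RealStructuresOrdinary] M. Goresky, Y.-S. Tai, *Real structures on ordinary abelian varieties*,
  arXiv:1701.07742 (2017), Appendix §17.1 (p. 39) and §16.2, Lemma 37 (pp. 36–37).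
-/

noncomputable section

open Matrix

namespace Literature.LinearAlgebra.Matrix

namespace SymplecticSimilitude

variable {R : Type*} [CommRing R] {m : Type*} [Fintype m] [DecidableEq m]

/-! ## §1 The block relations of `ᵗγJγ = qJ` -/

section Blocks

/-- The block formula: for `γ = (A B; C D)`,
`ᵗγJγ = (ᵗC A − ᵗA C   ᵗC B − ᵗA D; ᵗD A − ᵗB C   ᵗD B − ᵗB D)`.
[cite: GoreskyTai2017RealStructuresOrdinary, App. §17.1 (the computation behind «the symplectic condition
ᵗγJγ = qJ is equivalent to …»)] -/
theorem transpose_mul_J_mul_fromBlocks (A B C D : Matrix m m R) :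
    (fromBlocks A B C D)ᵀ * J m R * fromBlocks A B C D =
      fromBlocks (Cᵀ * A - Aᵀ * C) (Cᵀ * B - Aᵀ * D) (Dᵀ * A - Bᵀ * C) (Dᵀ * B - Bᵀ * D) := by
  simp only [fromBlocks_transpose, J, fromBlocks_multiply, mul_zero, mul_one, zero_add, add_zero, mul_neg,
    neg_mul, ← sub_eq_add_neg]

/-- **Goresky–Tai App. §17.1**: «expressing `γ` as a block matrix, `γ = (A B; C D)` the symplectic condition
`ᵗγJγ = qJ` is equivalent to: `ᵗA C`, `ᵗB D` are symmetric, and `ᵗA D − ᵗC B = qI`» — for every `q ∈ R` over any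
commutative ring (the case `q = 1` is Mathlib's `Matrix.SymplecticGroup.fromBlocks_mem_iff`).
[cite: GoreskyTai2017RealStructuresOrdinary, App. §17.1, first display after «the symplectic condition»] -/
theorem fromBlocks_transpose_mul_J_mul_eq_smul_J_iff (A B C D : Matrix m m R) (q : R) :
    (fromBlocks A B C D)ᵀ * J m R * fromBlocks A B C D = q • J m R ↔
      Aᵀ * C = Cᵀ * A ∧ Bᵀ * D = Dᵀ * B ∧ Aᵀ * D - Cᵀ * B = q • (1 : Matrix m m R) := by
  rw [transpose_mul_J_mul_fromBlocks, J, fromBlocks_smul, smul_zero, smul_neg, fromBlocks_inj]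
  constructor
  · rintro ⟨h₁, h₂, -, h₄⟩
    refine ⟨(sub_eq_zero.1 h₁).symm, (sub_eq_zero.1 h₄).symm, ?_⟩
    rwa [← neg_sub, neg_inj] at h₂
  · rintro ⟨h₁, h₄, h₂⟩
    refine ⟨sub_eq_zero.2 h₁.symm, by rw [← neg_sub, h₂], ?_, sub_eq_zero.2 h₄.symm⟩
    have := congrArg transpose h₂
    rwa [transpose_sub, transpose_mul, transpose_mul, transpose_transpose, transpose_transpose,
      transpose_smul, transpose_one] at this

end Blocks

/-! ## §2 «`qγ⁻¹ = (ᵗD −ᵗB; −ᵗC ᵗA)`» and «hence `ᵗγ` is also» -/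

section Adjugate

/-- The matrix `(ᵗD −ᵗB; −ᵗC ᵗA)` of the display «`qγ⁻¹ = …`» is `−JᵗγJ` for `γ = (A B; C D)` (the adjoint
`J⁻¹ᵗγJ`, `J⁻¹ = −J`). [cite: GoreskyTai2017RealStructuresOrdinary, App. §17.1, display «qγ⁻¹ = (ᵗD −ᵗB; −ᵗC ᵗA)»] -/
theorem neg_J_mul_transpose_mul_J_fromBlocks (A B C D : Matrix m m R) :
    -(J m R * (fromBlocks A B C D)ᵀ * J m R) = fromBlocks Dᵀ (-Bᵀ) (-Cᵀ) Aᵀ := by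
  simp only [fromBlocks_transpose, J, fromBlocks_multiply, fromBlocks_neg, zero_mul, mul_zero, one_mul, mul_one,
    neg_mul, mul_neg, neg_neg, zero_add, add_zero]

/-- `(−JᵗγJ)·γ = q·1` whenever `ᵗγJγ = qJ` (any `q ∈ R`) — the `B = J` case of the tree's
`SimilitudeCharpoly.inv_mul_transpose_mul_mul_eq` (`(B⁻¹ᵗgB)g = μ·1`). [folklore] -/
private theorem neg_J_mul_transpose_mul_J_mul_self {γ : Matrix (m ⊕ m) (m ⊕ m) R} {q : R}
    (h : γᵀ * J m R * γ = q • J m R) :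
    -(J m R * γᵀ * J m R) * γ = q • (1 : Matrix (m ⊕ m) (m ⊕ m) R) := by
  rw [← SimilitudeCharpoly.inv_mul_transpose_mul_mul_eq h (isUnit_det_J m R), J_inv]
  simp only [neg_mul]

/-- **Goresky–Tai App. §17.1, display «`qγ⁻¹ = (ᵗD −ᵗB; −ᵗC ᵗA)`»** in inverse-free form: if `ᵗγJγ = qJ` for
`γ = (A B; C D)` then `(ᵗD −ᵗB; −ᵗC ᵗA)·γ = q·1` (every `q ∈ R`, any commutative ring).
[cite: GoreskyTai2017RealStructuresOrdinary, App. §17.1, display «qγ⁻¹ = (ᵗD −ᵗB; −ᵗC ᵗA)»] -/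
theorem fromBlocks_adjugate_mul {A B C D : Matrix m m R} {q : R}
    (h : (fromBlocks A B C D)ᵀ * J m R * fromBlocks A B C D = q • J m R) :
    fromBlocks Dᵀ (-Bᵀ) (-Cᵀ) Aᵀ * fromBlocks A B C D = q • (1 : Matrix (m ⊕ m) (m ⊕ m) R) := by
  rw [← neg_J_mul_transpose_mul_J_fromBlocks]
  exact neg_J_mul_transpose_mul_J_mul_self h

/-- **Goresky–Tai App. §17.1, display «`qγ⁻¹ = (ᵗD −ᵗB; −ᵗC ᵗA)`»**: for a unit multiplier `q`,
`γ⁻¹ = q⁻¹·(ᵗD −ᵗB; −ᵗC ᵗA)` (the `B = J` case of the tree's `SimilitudeCharpoly.inv_eq_smul_inv_mul_transpose_mul`).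
[cite: GoreskyTai2017RealStructuresOrdinary, App. §17.1, display «qγ⁻¹ = (ᵗD −ᵗB; −ᵗC ᵗA)»] -/
theorem inv_eq_smul_fromBlocks {A B C D : Matrix m m R} (u : Rˣ)
    (h : (fromBlocks A B C D)ᵀ * J m R * fromBlocks A B C D = (u : R) • J m R) :
    (fromBlocks A B C D)⁻¹ = ((u⁻¹ : Rˣ) : R) • fromBlocks Dᵀ (-Bᵀ) (-Cᵀ) Aᵀ := by
  rw [SimilitudeCharpoly.inv_eq_smul_inv_mul_transpose_mul h (isUnit_det_J m R) (Units.inv_mul u), J_inv,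
    neg_mul, neg_mul, neg_J_mul_transpose_mul_J_fromBlocks]

/-- For a unit multiplier the symplectic adjoint is also a RIGHT inverse up to `q`: `γ·(−JᵗγJ) = q·1`
(«If `γ ∈ GSp_{2n}(R)` then so is `ᵗγ⁻¹`»). [cite: GoreskyTai2017RealStructuresOrdinary, App. §17.1] -/
theorem mul_neg_J_mul_transpose_mul_J {γ : Matrix (m ⊕ m) (m ⊕ m) R} (u : Rˣ)
    (h : γᵀ * J m R * γ = (u : R) • J m R) :
    γ * -(J m R * γᵀ * J m R) = (u : R) • (1 : Matrix (m ⊕ m) (m ⊕ m) R) := by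
  have h1 : (((u⁻¹ : Rˣ) : R) • -(J m R * γᵀ * J m R)) * γ = 1 := by
    rw [Matrix.smul_mul, neg_J_mul_transpose_mul_J_mul_self h, smul_smul, Units.inv_mul, one_smul]
  have h2 := mul_eq_one_comm.1 h1
  rw [Matrix.mul_smul] at h2
  calc γ * -(J m R * γᵀ * J m R)
      = (u : R) • (((u⁻¹ : Rˣ) : R) • (γ * -(J m R * γᵀ * J m R))) := by
        rw [smul_smul, Units.mul_inv, one_smul]
    _ = (u : R) • (1 : Matrix (m ⊕ m) (m ⊕ m) R) := by rw [h2]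

/-- **Goresky–Tai App. §17.1**: «If `γ ∈ GSp_{2n}(R)` then so is `ᵗγ⁻¹`, hence `ᵗγ` is also» — for a unit
multiplier, `ᵗγJγ = qJ` implies `γJᵗγ = qJ` (the transpose has the same multiplier).
[cite: GoreskyTai2017RealStructuresOrdinary, App. §17.1] -/
theorem mul_J_mul_transpose_eq_smul_J {γ : Matrix (m ⊕ m) (m ⊕ m) R} (u : Rˣ)
    (h : γᵀ * J m R * γ = (u : R) • J m R) :
    γ * J m R * γᵀ = (u : R) • J m R := by
  have e := mul_neg_J_mul_transpose_mul_J u h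
  rw [Matrix.mul_neg, neg_eq_iff_eq_neg] at e
  have e2 : γ * (J m R * γᵀ * J m R) * J m R = -((u : R) • (1 : Matrix (m ⊕ m) (m ⊕ m) R)) * J m R := by
    rw [e]
  have key : γ * (J m R * γᵀ * J m R) * J m R = -(γ * J m R * γᵀ) := by
    simp only [Matrix.mul_assoc, J_squared, Matrix.mul_neg, Matrix.mul_one]
  rw [key, Matrix.neg_mul, Matrix.smul_mul, Matrix.one_mul, neg_inj] at e2
  exact e2

/-- For a unit multiplier, `ᵗγJγ = qJ ↔ γJᵗγ = qJ`.
[cite: GoreskyTai2017RealStructuresOrdinary, App. §17.1 («hence `ᵗγ` is also»)] -/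
theorem transpose_mul_J_mul_eq_smul_J_iff_mul_J_mul_transpose {γ : Matrix (m ⊕ m) (m ⊕ m) R} (u : Rˣ) :
    γᵀ * J m R * γ = (u : R) • J m R ↔ γ * J m R * γᵀ = (u : R) • J m R := by
  constructor
  · exact mul_J_mul_transpose_eq_smul_J u
  · intro h
    have := mul_J_mul_transpose_eq_smul_J u (γ := γᵀ) (by rwa [transpose_transpose])
    rwa [transpose_transpose] at this

/-- **Goresky–Tai App. §17.1**, third display: for a unit multiplier `q`, `ᵗγJγ = qJ` for `γ = (A B; C D)` is
equivalent to «`AᵗB`, `CᵗD` are symmetric, and `AᵗD − BᵗC = qI`».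
[cite: GoreskyTai2017RealStructuresOrdinary, App. §17.1, display «AᵗB, CᵗD are symmetric, and AᵗD − BᵗC = qI»] -/
theorem fromBlocks_transpose_mul_J_mul_eq_smul_J_iff' (A B C D : Matrix m m R) (u : Rˣ) :
    (fromBlocks A B C D)ᵀ * J m R * fromBlocks A B C D = (u : R) • J m R ↔
      A * Bᵀ = B * Aᵀ ∧ C * Dᵀ = D * Cᵀ ∧ A * Dᵀ - B * Cᵀ = (u : R) • (1 : Matrix m m R) := by
  rw [transpose_mul_J_mul_eq_smul_J_iff_mul_J_mul_transpose u]
  have key := fromBlocks_transpose_mul_J_mul_eq_smul_J_iff Aᵀ Cᵀ Bᵀ Dᵀ (u : R)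
  rw [← fromBlocks_transpose] at key
  simp only [transpose_transpose] at key
  exact key

end Adjugate

/-! ## §3 Lemma 37 for `GSp_{2n}`: `det(q·1 − x·γ) = qⁿ·p(x)` and `a_{n−r} = q^r a_{n+r}` -/

section Charpoly

open Polynomial

/-- **Goresky–Tai Lemma 37, in the equivalent form «`q^{−n} x^{2n} p(q/x) = p(x)`»**, stated inverse-free as the
polynomial identity `det(q·1 − x·γ) = qⁿ·p(x)` in `R[x]` (`x^{2n} p(q/x) = det(q·1 − x·γ)` is the tree's
`SimilitudeCharpoly.det_scalar_sub_X_smul_eq_reflect`): for `ᵗγJγ = qJ`, EVERY `q ∈ R`, any commutative ring.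
Corollary of the tree's `SimilitudeCharpoly.C_det_mul_charpoly` (Book of Involutions (12.2): `det γ · p(x) =
(−1)^{2n} det(q·1 − x·γ)`) and `det γ = qⁿ` (`det_eq_pow_card_of_transpose_mul_J_mul_eq_smul`, the Pfaffian road) —
a documented deviation from the printed diagonalisation.
[cite: GoreskyTai2017RealStructuresOrdinary, App. §16.2 Lemma 37 (with the definition of `q`-palindromic, p. 36)] -/
theorem det_scalar_sub_X_smul_map {γ : Matrix (m ⊕ m) (m ⊕ m) R} {q : R}
    (h : γᵀ * J m R * γ = q • J m R) :
    (Matrix.scalar (m ⊕ m) (C q) - (X : R[X]) • γ.map C).det = C (q ^ Fintype.card m) * γ.charpoly := by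
  have e := SimilitudeCharpoly.C_det_mul_charpoly h (isUnit_det_J m R).isRegular
  rw [det_eq_pow_card_of_transpose_mul_J_mul_eq_smul γ h, Fintype.card_sum, ← two_mul, pow_mul, neg_one_sq,
    one_pow, one_mul] at e
  exact e.symm

/-- **Goresky–Tai Lemma 37** as printed: «Let `γ ∈ GSp_{2n}` with multiplier `q`.  Then the characteristic
polynomial `p(x) = ∑ a_k x^k` of `γ` is `q`-palindromic», i.e. «`a_{n−r} = q^r a_{n+r}` for `1 ≤ r ≤ n`» — here for
`0 ≤ r ≤ n` and every REGULAR multiplier `q` (a non-zero-divisor: any `q ≠ 0` of an integral domain, e.g.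
`GSp_{2n}(ℚ)` or an integer similitude of multiplier `pᵃ`; `isRegular_of_ne_zero'`), over any commutative ring.
Corollary of the tree's `SimilitudeCharpoly.coeff_charpoly_eq_pow_mul_coeff` (Book of Involutions (12.2)–(12.3),
`a_i = q^{n−i} a_{2n−i}`) with `det γ = qⁿ` (`det_eq_pow_card_of_transpose_mul_J_mul_eq_smul`).
[cite: GoreskyTai2017RealStructuresOrdinary, App. §16.2 Lemma 37] -/
theorem charpoly_coeff_eq_pow_mul_charpoly_coeff {γ : Matrix (m ⊕ m) (m ⊕ m) R} {q : R}
    (h : γᵀ * J m R * γ = q • J m R) (hq : IsRegular q) {r : ℕ} (hr : r ≤ Fintype.card m) :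
    γ.charpoly.coeff (Fintype.card m - r) = q ^ r * γ.charpoly.coeff (Fintype.card m + r) := by
  have e := SimilitudeCharpoly.coeff_charpoly_eq_pow_mul_coeff h (isUnit_det_J m R).isRegular hq
    (k := Fintype.card m) (by rw [Fintype.card_sum, two_mul]) (det_eq_pow_card_of_transpose_mul_J_mul_eq_smul γ h)
    (i := Fintype.card m - r) (Nat.sub_le _ _)
  rwa [Nat.sub_sub_self hr, show 2 * Fintype.card m - (Fintype.card m - r) = Fintype.card m + r by omega] at e

end Charpoly

end SymplecticSimilitude

end Literature.LinearAlgebra.Matrix
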